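import Summits.QuantumFields.YangMills.Theorems.F4SubCurvatureDoorShortRootRigidityPlanarInitialAperture
import HarnessLib

/-!
# `stub_planarInitialAperture` of LINE g21-C «aperture bootstrap» (crux ⟨stmt-QuantumFields-23035⟩ `ShortRootRigidity`) BY NAME AND SIGNATURE

Registered skeleton `Cruxes/ShortRootRigidity/Lines/aperture_bootstrap.lean` (planner ym-idea-3 g21, commit cba045e6138d, sha16 2f950b347c67e923;
critic idea-crit-4 g9 PASS A−), stub `:132 theorem stub_planarInitialAperture : PlanarInitialAperture`.  The Prop (with its vocabulary `IsPlanarLF`,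
`HasAperture`) is the CHARACTER-IDENTICAL restatement of the landed rung file `…ShortRootRigidityPlanarInitialAperture` (this seat, p722363), and the
proof is that file's `planarInitialAperture_holds`.

HONEST LABEL: one registered stub (S) of an OPEN line; `stub_planarApertureStep` (L, THE step), `stub_planarSpectralCone_of_coneSupport`,
`stub_oddModeRigidity`, (C), ⟨23035⟩, R2d and the Yang–Mills mass gap remain OPEN; no summit is proved by a line.  Lead seat `ym-line-sfw-p2` g75.
-/

set_option autoImplicit false

namespace Summit.QuantumFields.YangMills.Theorems.F4SubCurvatureDoorApertureBootstrapStubInitialAperture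

open Summit.QuantumFields.YangMills.Theorems.F4SubCurvatureDoorPlanarInitialApertureRegistered
  (PlanarInitialAperture planarInitialAperture_holds)

/-- **Registered stub `:132` of LINE g21-C, BY NAME AND SIGNATURE**: `PlanarInitialAperture`. -/
theorem stub_planarInitialAperture : PlanarInitialAperture := planarInitialAperture_holds

end Summit.QuantumFields.YangMills.Theorems.F4SubCurvatureDoorApertureBootstrapStubInitialAperture
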